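import Literature.NumberTheory.Sieve.LargeGapsBetweenPrimes
import Literature.NumberTheory.Sieve.McCurleyCovering
import HarnessLib

/-!
# Rankin's theorem from McCurley's covering theorem (`n = 1`), and the covering-to-gap transfer
# at Rankin's rate

Topic `Literature/NumberTheory/Sieve`. Everything in this file is PROVED.

The tree proves McCurley's covering theorem (K. S. McCurley, *The smallest prime value of `xⁿ + a`*,
Can. J. Math. 38 (1986), Theorem 3, §4) for every `n ≥ 1`
(`Literature.NumberTheory.Sieve.McCurley.exists_powClasses_cover`, file `McCurleyCovering.lean`):
residues `c_p (mod p)`, `p ≤ w`, with `mⁿ + c_p ≡ 0 (mod p)` for some `p ≤ w` whenever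
`0 ≤ m ≤ α (w/log₂ w)(log w · log₃ w/log₂ w)^{d(n)}`. McCurley: "Rankin [10] was the first to prove
this result in the case `n = 1`" — for `n = 1` (`d(1) = 1`) it is exactly Rankin's 1938 covering
`Y(w) ≥ α · w log w log₃ w/(log₂ w)²` of `LargeGapsBetweenPrimes.lean` (`ResidueClassesCover`). This
file records that link in the kernel and carries it to consecutive primes:

* `residueClassesCover_of_mccurley`: `∃ α > 0`, for all large `w`,
  `ResidueClassesCover w ⌊α · w log w log₃ w/(log₂ w)²⌋` (McCurley's theorem at `n = 1`, classes
  `-c_p`);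
* `RankinTransfer.eventually_hasPrimeGap_of_cover`, `rankinConstant_of_cover`: the general
  TRANSFER — a covering `Y(w) ≥ ⌊α · w log w log₃ w/(log₂ w)²⌋` for all large `w` gives
  `G(X) ≥ (α/64) · log X log₂ X log₄ X/(log₃ X)²` for all large `X`, hence `RankinConstant (α/64)`
  (Ford–Green–Konyagin–Tao's Lemma 1.1 `hasPrimeGap_of_cover` with `w = ⌊log X/3⌋`, `P(w) ≤ 4ʷ ≤ √X`,
  and the bookkeeping `log w ≥ log₂ X/2`, `log₂ w ≤ log₃ X`, `log₃ w ≥ log₄ X/2`);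
* `exists_rankinConstant_of_mccurley`: `∃ c > 0, RankinConstant c` — a second derivation of the
  named fact `Rankin1938_existsConstant` (Montgomery–Vaughan Theorem 7.15, discharged in the tree by
  `Rankin38.rankin1938_existsConstant_holds` of `LargeGapsRankinProofs.lean`, which re-derives the
  covering from Montgomery–Vaughan's inputs with the explicit `c = 1/21504`), here independent of
  that file.

## References

* K. S. McCurley, Can. J. Math. 38 (1986) 925–936, Theorem 3 and §4 ("For `n = 1`, this is exactly
  the proof outlined by Rankin"). [McCurley1986SmallestPrimeValue]
* R. A. Rankin, J. London Math. Soc. 13 (1938) 242–247. [Rankin1938]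
* K. Ford, B. Green, S. Konyagin, T. Tao, Ann. of Math. 183 (2016), Lemma 1.1 and (1.2).
  [FordGreenKonyaginTao2016]
* H. L. Montgomery, R. C. Vaughan, *Multiplicative Number Theory I*, Theorem 7.15.
  [MontgomeryVaughan2007]
-/

open Filter Finset

namespace Literature.NumberTheory.Sieve

/-! ### McCurley's theorem at `n = 1` is Rankin's covering -/

/-- **Rankin's covering from McCurley's theorem (`n = 1`).** There is `α > 0` such that for all
large `w` one residue class per prime `p ≤ w` covers `{1, …, ⌊α · w log w log₃ w/(log₂ w)²⌋}`:
`Y(w) ≥ α · w log w log₃ w/(log₂ w)²` up to rounding (McCurley's classes `c_p` with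
`m + c_p ≡ 0 (mod p)` cover `0 ≤ m ≤ α (w/log₂ w)(log w log₃ w/log₂ w)^{d(1)}`, `d(1) = 1`; the
covering classes are `-c_p`).
[cite: McCurley1986SmallestPrimeValue, Theorem 3 (p. 927) and §4 (n = 1: "exactly the proof outlined by Rankin")]
[cite: Rankin1938, Theorem] -/
theorem residueClassesCover_of_mccurley :
    ∃ α : ℝ, 0 < α ∧ ∀ᶠ w : ℕ in atTop, ResidueClassesCover w
      ⌊α * ((w : ℝ) * Real.log w * Real.log (Real.log (Real.log w)) /
        (Real.log (Real.log w)) ^ 2)⌋₊ := by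
  obtain ⟨α, hα, hcov⟩ := McCurley.exists_powClasses_cover (n := 1) le_rfl
  refine ⟨α, hα, ?_⟩
  filter_upwards [hcov] with w hw
  obtain ⟨c, hc⟩ := hw
  have hd : #(Nat.divisors 1) = 1 := by decide
  refine ⟨fun p => p - c p % p, fun t ht1 ht2 => ?_⟩
  set v : ℝ := α * ((w : ℝ) * Real.log w * Real.log (Real.log (Real.log w)) /
    (Real.log (Real.log w)) ^ 2) with hv
  -- `t ≤ v` (the floor is `0` if `v < 0`, contradicting `1 ≤ t`)
  have htv : (t : ℝ) ≤ v := by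
    rcases le_or_gt 0 v with hnonneg | hneg
    · exact le_trans (by exact_mod_cast ht2) (Nat.floor_le hnonneg)
    · exfalso
      rw [Nat.floor_of_nonpos hneg.le] at ht2
      omega
  have ht : (t : ℝ) ≤ α * ((w : ℝ) / Real.log (Real.log w) *
      (Real.log w * Real.log (Real.log (Real.log w)) / Real.log (Real.log w)) ^ #(Nat.divisors 1)) := by
    rw [hd, pow_one]
    refine htv.trans (le_of_eq ?_)
    rw [hv]
    ring
  obtain ⟨p, hp, hpw, hdvd⟩ := hc t ht
  rw [pow_one] at hdvd
  have hk : c p % p ≤ p := (Nat.mod_lt _ hp.pos).le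
  have h : t + c p % p ≡ (p - c p % p) + c p % p [MOD p] := by
    rw [Nat.sub_add_cancel hk]
    calc t + c p % p ≡ t + c p [MOD p] := (Nat.ModEq.refl t).add (Nat.mod_modEq _ _)
      _ ≡ 0 [MOD p] := Nat.modEq_zero_iff_dvd.2 hdvd
      _ ≡ p [MOD p] := (Nat.modEq_zero_iff_dvd.2 dvd_rfl).symm
  exact ⟨p, hp, hpw, Nat.ModEq.add_right_cancel' (c p % p) h⟩

/-! ### The transfer: a covering at Rankin's rate gives gaps at Rankin's rate -/

namespace RankinTransfer

/-- The gap for one `X`, all parameters explicit (`z = ⌊log X/3⌋`, `ℓ = log z`, `ℓ₂ = log ℓ`,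
`ℓ₃ = log ℓ₂`, `t = log₂ X`, `s = log₃ X`, `r = log₄ X`, `U` the covered length at `z`).
[folklore] -/
private theorem gap_of_params {α X ℓ ℓ₂ ℓ₃ t s r : ℝ} {z U : ℕ} (hα : 0 < α)
    (hz : z = ⌊Real.log X / 3⌋₊)
    (hℓ : ℓ = Real.log z) (hℓ₂ : ℓ₂ = Real.log ℓ) (hℓ₃ : ℓ₃ = Real.log ℓ₂)
    (ht : t = Real.log (Real.log X)) (hs : s = Real.log t) (hr : r = Real.log s)
    (hU : U = ⌊α * ((z : ℝ) * ℓ * ℓ₃ / ℓ₂ ^ 2)⌋₊)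
    (hcovX : ResidueClassesCover z U) (hz3 : 3 ≤ z) (hlogXα : 64 / α ≤ Real.log X)
    (hoT : Real.log t ^ 2 ≤ 1 * t) (hoX : α * Real.log X ^ 2 ≤ 1 / 8 * X)
    (hlinX : Real.log X ≤ 1 / 8 * X) (hT3 : 3 ≤ t) (hr2 : 2 ≤ r) (hX16 : 16 ≤ X)
    (hX12 : Real.exp 12 ≤ X) :
    HasPrimeGap X (α / 64 * rankinRate X) := by
  have hXpos : 0 < X := by linarith
  have hlogX12 : 12 ≤ Real.log X := by
    have := Real.log_le_log (Real.exp_pos 12) hX12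
    rwa [Real.log_exp] at this
  have hlogXpos : 0 < Real.log X := by linarith
  have ht0 : 0 < t := by linarith
  -- `s ≥ 3`, `r ≤ s - 1`
  have hsr : r ≤ s - 1 := by
    have hs1 : 1 < s := by
      rw [hs, ← Real.exp_lt_exp, Real.exp_log ht0]
      have := Real.exp_one_lt_d9; linarith
    rw [hr]; exact Real.log_le_sub_one_of_pos (by linarith)
  have hs3 : 3 ≤ s := by linarith
  have hs0 : 0 < s := by linarith
  have hr0 : 0 < r := by linarith
  have hzr : (3 : ℝ) ≤ z := by exact_mod_cast hz3
  have hz0 : (0 : ℝ) < z := by linarith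
  have hzle : (z : ℝ) ≤ Real.log X / 3 := by rw [hz]; exact Nat.floor_le (by positivity)
  have hzge : Real.log X / 3 - 1 < z := by rw [hz]; exact Nat.sub_one_lt_floor _
  have hz4 : Real.log X / 4 ≤ z := by linarith
  -- `ℓ ≥ t/2`, `ℓ ≤ t`, `ℓ₂ ≤ s`, `ℓ₂ ≥ s/2`, `ℓ₃ ≥ r/2`, `ℓ₃ ≤ ℓ₂ - 1`
  have hlog4 : Real.log 4 ≤ 3 / 2 := by
    rw [show (4 : ℝ) = 2 ^ 2 by norm_num, Real.log_pow]
    have := Real.log_two_lt_d9; norm_num at this ⊢; linarith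
  have hℓge : t / 2 ≤ ℓ := by
    have h1 : Real.log (Real.log X / 4) ≤ ℓ := by
      rw [hℓ]; exact Real.log_le_log (by positivity) hz4
    rw [Real.log_div hlogXpos.ne' (by norm_num), ← ht] at h1
    linarith
  have hℓle : ℓ ≤ t := by
    rw [hℓ, ht]
    exact Real.log_le_log hz0 (by linarith)
  have hℓ0 : 0 < ℓ := by linarith
  have hℓ₂le : ℓ₂ ≤ s := by rw [hℓ₂, hs]; exact Real.log_le_log hℓ0 hℓle
  have hlog2 : Real.log 2 ≤ 1 := by
    have := Real.log_two_lt_d9; norm_num at this; linarith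
  have hℓ₂ge : s / 2 ≤ ℓ₂ := by
    have h1 : Real.log (t / 2) ≤ ℓ₂ := by rw [hℓ₂]; exact Real.log_le_log (by positivity) hℓge
    rw [Real.log_div ht0.ne' (by norm_num), ← hs] at h1
    linarith
  have hℓ₂0 : 0 < ℓ₂ := by linarith
  have hℓ₂1 : 1 ≤ ℓ₂ := by linarith
  have hℓ₃ge : r / 2 ≤ ℓ₃ := by
    have h1 : Real.log (s / 2) ≤ ℓ₃ := by rw [hℓ₃]; exact Real.log_le_log (by positivity) hℓ₂ge
    rw [Real.log_div hs0.ne' (by norm_num), ← hr] at h1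
    linarith
  have hℓ₃0 : 0 < ℓ₃ := by linarith
  have hℓ₃le : ℓ₃ ≤ ℓ₂ - 1 := by rw [hℓ₃]; exact Real.log_le_sub_one_of_pos hℓ₂0
  -- the covered length `U`: `V - 1 < U ≤ V` with `V = α z ℓ ℓ₃/ℓ₂²`
  have hV0 : 0 ≤ α * ((z : ℝ) * ℓ * ℓ₃ / ℓ₂ ^ 2) := by positivity
  have hUle : (U : ℝ) ≤ α * ((z : ℝ) * ℓ * ℓ₃ / ℓ₂ ^ 2) := by rw [hU]; exact Nat.floor_le hV0
  have hUge : α * ((z : ℝ) * ℓ * ℓ₃ / ℓ₂ ^ 2) - 1 < U := by rw [hU]; exact Nat.sub_one_lt_floor _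
  -- `R = log X · t · r/s²` and `z ℓ ℓ₃/ℓ₂² ≥ R/16`
  have hR0 : 0 ≤ Real.log X * t * r / s ^ 2 := by positivity
  have hRle : Real.log X * t * r / s ^ 2 / 16 ≤ (z : ℝ) * ℓ * ℓ₃ / ℓ₂ ^ 2 := by
    rw [div_div, div_le_div_iff₀ (by positivity) (by positivity)]
    have h2 : ℓ₂ ^ 2 ≤ s ^ 2 := pow_le_pow_left₀ hℓ₂0.le hℓ₂le 2
    have h3 : Real.log X * t * r ≤ (4 * z) * (2 * ℓ) * (2 * ℓ₃) :=
      mul_le_mul (mul_le_mul (by linarith) (by linarith) ht0.le (by positivity)) (by linarith)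
        hr0.le (by positivity)
    calc Real.log X * t * r * ℓ₂ ^ 2 ≤ (4 * z) * (2 * ℓ) * (2 * ℓ₃) * s ^ 2 :=
          mul_le_mul h3 h2 (sq_nonneg _) (by positivity)
      _ = (z : ℝ) * ℓ * ℓ₃ * (s ^ 2 * 16) := by ring
  -- `R ≥ log X · r ≥ 2 log X` (from `s² = (log t)² ≤ t`)
  have hst : s ^ 2 ≤ t := by rw [hs]; linarith
  have hRge : 2 * Real.log X ≤ Real.log X * t * r / s ^ 2 := by
    rw [le_div_iff₀ (by positivity)]
    have h1 : 2 * Real.log X * s ^ 2 ≤ 2 * Real.log X * t :=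
      mul_le_mul_of_nonneg_left hst (by positivity)
    have h2 : 2 * Real.log X * t ≤ Real.log X * t * r := by
      have := mul_le_mul_of_nonneg_left hr2 (show 0 ≤ Real.log X * t by positivity)
      linarith
    linarith
  -- hence `U ≥ 1`
  have hαlogX : 64 ≤ α * Real.log X := by
    have := mul_le_mul_of_nonneg_left hlogXα hα.le
    rwa [mul_div_cancel₀ _ hα.ne'] at this
  have hU7 : (7 : ℝ) ≤ U := by
    have h1 : α * (Real.log X * t * r / s ^ 2 / 16) ≤ α * ((z : ℝ) * ℓ * ℓ₃ / ℓ₂ ^ 2) :=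
      mul_le_mul_of_nonneg_left hRle hα.le
    have h2 : α * (2 * Real.log X) ≤ α * (Real.log X * t * r / s ^ 2) :=
      mul_le_mul_of_nonneg_left hRge hα.le
    have h3 : α * (Real.log X * t * r / s ^ 2 / 16) = α * (Real.log X * t * r / s ^ 2) / 16 := by
      ring
    linarith
  have hU1 : 1 ≤ U := by exact_mod_cast (show (1 : ℝ) ≤ U by linarith)
  -- the gap supplied by the cover
  have hgap := hasPrimeGap_of_cover hcovX hU1
  refine hgap.mono ?_ ?_
  · -- `2 (z + P(z) + U) ≤ X`
    have hprim : ((primorial z : ℕ) : ℝ) ≤ Real.sqrt X := by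
      have h4 : ((primorial z : ℕ) : ℝ) ≤ (4 : ℝ) ^ (z : ℝ) := by
        rw [Real.rpow_natCast]; exact_mod_cast primorial_le_four_pow z
      refine h4.trans ?_
      rw [Real.sqrt_eq_rpow, Real.rpow_def_of_pos (by norm_num : (0 : ℝ) < 4),
        Real.rpow_def_of_pos hXpos, Real.exp_le_exp]
      calc Real.log 4 * (z : ℝ) ≤ 3 / 2 * (Real.log X / 3) := by gcongr
        _ = Real.log X * (1 / 2) := by ring
    have hsqrt : Real.sqrt X ≤ X / 4 := by
      have h16 : Real.sqrt 16 = 4 := by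
        rw [show (16 : ℝ) = 4 ^ 2 by norm_num, Real.sqrt_sq (by norm_num)]
      have h4 : 4 ≤ Real.sqrt X := h16 ▸ Real.sqrt_le_sqrt hX16
      have h5 := Real.mul_self_sqrt hXpos.le
      have h6 := mul_le_mul_of_nonneg_right h4 (Real.sqrt_nonneg X)
      linarith only [h5, h6]
    -- `U ≤ α z ℓ ≤ α log² X ≤ X/8`
    have hVle : (z : ℝ) * ℓ * ℓ₃ / ℓ₂ ^ 2 ≤ (z : ℝ) * ℓ := by
      rw [div_le_iff₀ (by positivity)]
      have h1 : ℓ₃ ≤ ℓ₂ ^ 2 := by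
        have : ℓ₂ ≤ ℓ₂ ^ 2 := by rw [sq]; exact le_mul_of_one_le_left hℓ₂0.le hℓ₂1
        linarith only [this, hℓ₃le]
      calc (z : ℝ) * ℓ * ℓ₃ ≤ (z : ℝ) * ℓ * ℓ₂ ^ 2 :=
            mul_le_mul_of_nonneg_left h1 (by positivity)
        _ = (z : ℝ) * ℓ * ℓ₂ ^ 2 := rfl
    have htX : t ≤ Real.log X := by
      rw [ht]; exact (Real.log_le_sub_one_of_pos hlogXpos).trans (by linarith)
    have hzℓ : (z : ℝ) * ℓ ≤ Real.log X ^ 2 :=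
      calc (z : ℝ) * ℓ ≤ Real.log X / 3 * Real.log X :=
            mul_le_mul hzle (hℓle.trans htX) hℓ0.le (by positivity)
        _ ≤ Real.log X ^ 2 := by
            rw [sq]; exact mul_le_mul_of_nonneg_right (by linarith) hlogXpos.le
    have hN : (U : ℝ) ≤ 1 / 8 * X :=
      calc (U : ℝ) ≤ α * ((z : ℝ) * ℓ * ℓ₃ / ℓ₂ ^ 2) := hUle
        _ ≤ α * Real.log X ^ 2 := mul_le_mul_of_nonneg_left (hVle.trans hzℓ) hα.le
        _ ≤ 1 / 8 * X := hoX
    have hzX : (z : ℝ) ≤ 1 / 24 * X := by linarith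
    linarith only [hzX, hprim, hsqrt, hN]
  · -- `(α/64) · rankinRate X ≤ U + 1`
    have i2 : Real.log^[2] X = t := by
      rw [ht]; simp [Function.iterate_succ_apply']
    have i3 : Real.log^[3] X = s := by
      rw [hs, ht]; simp [Function.iterate_succ_apply']
    have i4 : Real.log^[4] X = r := by
      rw [hr, hs, ht]; simp [Function.iterate_succ_apply']
    rw [rankinRate, i2, i3, i4]
    push_cast
    have h1 : α / 64 * (Real.log X * t * r / s ^ 2) ≤
        α * (Real.log X * t * r / s ^ 2 / 16) := by
      have h2 : α / 64 * (Real.log X * t * r / s ^ 2) =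
          α * (Real.log X * t * r / s ^ 2 / 16) / 4 := by ring
      rw [h2, div_le_iff₀ (by norm_num : (0 : ℝ) < 4)]
      have h3 : 0 ≤ α * (Real.log X * t * r / s ^ 2 / 16) := by positivity
      linarith
    have h2 : α * (Real.log X * t * r / s ^ 2 / 16) ≤ α * ((z : ℝ) * ℓ * ℓ₃ / ℓ₂ ^ 2) :=
      mul_le_mul_of_nonneg_left hRle hα.le
    linarith

open Asymptotics in
/-- **The transfer at Rankin's rate.** If for all large `w` one residue class per prime `p ≤ w`
covers `{1, …, ⌊α · w log w log₃ w/(log₂ w)²⌋}`, then for all large `X` there are consecutive primes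
`p_n < p_{n+1} ≤ X` with `p_{n+1} − p_n ≥ (α/64) log X log₂ X log₄ X/(log₃ X)²` (the covering at
`w = ⌊log X/3⌋` transferred by Ford–Green–Konyagin–Tao's Lemma 1.1, `P(w) ≤ 4ʷ ≤ √X`).
[cite: FordGreenKonyaginTao2016, Lemma 1.1 and (1.2) (p. 936)] -/
theorem eventually_hasPrimeGap_of_cover {α : ℝ} (hα : 0 < α)
    (hcov : ∀ᶠ w : ℕ in atTop, ResidueClassesCover w
      ⌊α * ((w : ℝ) * Real.log w * Real.log (Real.log (Real.log w)) /
        (Real.log (Real.log w)) ^ 2)⌋₊) :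
    ∀ᶠ X : ℝ in atTop, HasPrimeGap X (α / 64 * rankinRate X) := by
  have hz : Tendsto (fun X : ℝ => ⌊Real.log X / 3⌋₊) atTop atTop :=
    tendsto_nat_floor_atTop.comp (Real.tendsto_log_atTop.atTop_div_const (by norm_num))
  have hT₂ : Tendsto (fun X : ℝ => Real.log (Real.log X)) atTop atTop :=
    Real.tendsto_log_atTop.comp Real.tendsto_log_atTop
  have hT₄ : Tendsto (fun X : ℝ => Real.log (Real.log (Real.log (Real.log X)))) atTop atTop :=
    Real.tendsto_log_atTop.comp (Real.tendsto_log_atTop.comp hT₂)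
  have ho := (Real.isLittleO_pow_log_id_atTop (n := 2)).bound (show (0 : ℝ) < 1 by norm_num)
  have hoX := (Real.isLittleO_pow_log_id_atTop (n := 2)).bound
    (show (0 : ℝ) < 1 / (8 * α) by positivity)
  have hlin := Real.isLittleO_log_id_atTop.bound (show (0 : ℝ) < 1 / 8 by norm_num)
  filter_upwards [hz.eventually hcov, hz.eventually (eventually_ge_atTop 3), hT₂.eventually ho,
    hoX, hlin, hT₂.eventually_ge_atTop 3, hT₄.eventually_ge_atTop 2, eventually_ge_atTop (16 : ℝ),
    eventually_ge_atTop (Real.exp 12), Real.tendsto_log_atTop.eventually_ge_atTop (64 / α)]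
    with X hcovX hz3 hoT hoX' hlinX hT3 hr2 hX16 hX12 hlogXα
  have hXpos : 0 < X := by linarith
  have hlogXpos : 0 < Real.log X := Real.log_pos (by linarith)
  have ht0 : 0 < Real.log (Real.log X) := by linarith
  rw [Real.norm_eq_abs, Real.norm_eq_abs, id, abs_of_nonneg (by positivity),
    abs_of_nonneg ht0.le] at hoT
  rw [Real.norm_eq_abs, Real.norm_eq_abs, id, abs_of_nonneg (by positivity),
    abs_of_pos hXpos] at hoX'
  rw [Real.norm_eq_abs, Real.norm_eq_abs, id, abs_of_pos hlogXpos, abs_of_pos hXpos] at hlinX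
  have hoX'' : α * Real.log X ^ 2 ≤ 1 / 8 * X := by
    have h := mul_le_mul_of_nonneg_left hoX' hα.le
    calc α * Real.log X ^ 2 ≤ α * (1 / (8 * α) * X) := h
      _ = 1 / 8 * X := by field_simp
  exact gap_of_params hα rfl rfl rfl rfl rfl rfl rfl rfl hcovX hz3 hlogXα hoT hoX'' hlinX hT3 hr2
    hX16 hX12

/-- `rankinRate X ≥ 0` for all large `X`. [folklore] -/
private theorem eventually_rankinRate_nonneg : ∀ᶠ X : ℝ in atTop, 0 ≤ rankinRate X := by
  have hT₂ : Tendsto (fun X : ℝ => Real.log (Real.log X)) atTop atTop :=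
    Real.tendsto_log_atTop.comp Real.tendsto_log_atTop
  have hT₄ : Tendsto (fun X : ℝ => Real.log (Real.log (Real.log (Real.log X)))) atTop atTop :=
    Real.tendsto_log_atTop.comp (Real.tendsto_log_atTop.comp hT₂)
  filter_upwards [Real.tendsto_log_atTop.eventually_ge_atTop 0, hT₂.eventually_ge_atTop 0,
    hT₄.eventually_ge_atTop 0] with X h1 h2 h4
  have i2 : Real.log^[2] X = Real.log (Real.log X) := by simp [Function.iterate_succ_apply']
  have i4 : Real.log^[4] X = Real.log (Real.log (Real.log (Real.log X))) := by
    simp [Function.iterate_succ_apply']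
  rw [rankinRate, i2, i4]
  positivity

/-- **Covering ⇒ Rankin constant.** A covering `Y(w) ≥ ⌊α · w log w log₃ w/(log₂ w)²⌋` for all
large `w` gives `RankinConstant (α/64)`: `G(X) ≥ (α/64 − ε) log X log₂ X log₄ X/(log₃ X)²` for every
`ε > 0` and all large `X`. [cite: FordGreenKonyaginTao2016, Lemma 1.1 and (1.2) (p. 936)]
[cite: MontgomeryVaughan2007, Theorem 7.15 (proof)] -/
theorem rankinConstant_of_cover {α : ℝ} (hα : 0 < α)
    (hcov : ∀ᶠ w : ℕ in atTop, ResidueClassesCover w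
      ⌊α * ((w : ℝ) * Real.log w * Real.log (Real.log (Real.log w)) /
        (Real.log (Real.log w)) ^ 2)⌋₊) :
    RankinConstant (α / 64) := by
  intro ε hε
  filter_upwards [eventually_hasPrimeGap_of_cover hα hcov, eventually_rankinRate_nonneg]
    with X hX hr
  exact hX.mono le_rfl (by nlinarith)

end RankinTransfer

/-! ### Rankin's theorem via McCurley -/

/-- **Rankin 1938 via McCurley 1986 (`n = 1`)**: there is `c > 0` with `RankinConstant c`, read
off the tree's McCurley covering theorem by the transfer `RankinTransfer.rankinConstant_of_cover`.
[cite: McCurley1986SmallestPrimeValue, Theorem 3 (p. 927), case n = 1] [cite: Rankin1938, Theorem] -/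
theorem exists_rankinConstant_of_mccurley : ∃ c : ℝ, 0 < c ∧ RankinConstant c := by
  obtain ⟨α, hα, hcov⟩ := residueClassesCover_of_mccurley
  exact ⟨α / 64, by positivity, RankinTransfer.rankinConstant_of_cover hα hcov⟩

/-- **Montgomery–Vaughan Theorem 7.15 / Rankin 1938 — a second derivation** of the named fact
`Rankin1938_existsConstant` (already discharged in the tree by
`Rankin38.rankin1938_existsConstant_holds`, `LargeGapsRankinProofs.lean`; not restated as a
declaration), from McCurley's covering theorem at `n = 1`. [cite: MontgomeryVaughan2007, Theorem 7.15]
[cite: McCurley1986SmallestPrimeValue, Theorem 3 (p. 927), case n = 1] -/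
example : Rankin1938_existsConstant := exists_rankinConstant_of_mccurley

/-- Consistency: hence also Erdős 1935 and Westzynthius 1931 through the chain of
`LargeGapsBetweenPrimes.lean`. [folklore] -/
example : Westzynthius1931 :=
  westzynthius1931_of_erdos1935
    (erdos1935_of_rankin1938_existsConstant exists_rankinConstant_of_mccurley)

end Literature.NumberTheory.Sieve
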